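import Literature.Computability.Complexity.PRelOfFunPolyExists
import Literature.Computability.AlgebraicComplexity.PRelPermanentNSUBEXP
import Literature.Computability.AlgebraicComplexity.PermanentGraphNSUBEXPProofs
import Literature.Computability.QuantumComplexity.PermanentHardnessProofs
import Literature.Barriers.ValiantsHypothesis.BIJL18TransferProofs
import HarnessLib

/-!
# Bläser–Ikenmeyer–Jindal–Lysikov 2018, Thm. 5 (`VP⁰ = VNP⁰ ⇒ P^{#P} ⊆ ∃·BPP`) REDUCED to a
# randomised identity test on the Kabanets–Impagliazzo instances

Theorem-only companion of `BIJL18PermanentZero.lean` (typed fact `BIJL2018_thm5`) and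
`BIJL18TransferProofs.lean`. The printed proof (ECCC TR18-064, §6, pp. 18–19): under `VP⁰ = VNP⁰` the
permanent has p-bounded constant-free circuits; an `∃·BPP` machine guesses them, VERIFIES them by
polynomial identity testing against the downward self-reduction of the permanent, and evaluates —
so `P^{#P} ⊆ P^{per} ⊆ ∃·BPP`. The tree already holds every deterministic ingredient for
Kabanets–Impagliazzo's twin argument (STOC 2003, Lemma 11 / Cor. 12 / Lemma 3, the `PIT ∈ NSUBEXP`
version): the reduction `KIReduction.kiRed ∈ FP` writing ONE identity-test instance with
`x ∈ graph(per) ↔ ∃ y, kiRed ⟨x, y⟩ ∈ PITLanguage` (`PermanentGraphNSUBEXPProofs.lean`), Valiant's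
`P^{#P} ⊆ P^{per}` (`PSharpP_subset_PRel_per01Fn`), the canonicalisation of permanent queries
(`PRelPermanentNSUBEXP.lean`), and `per ∈ VNP⁰` (`isVNP0Family_perPoly_finProd`). With the witness-class
form of KI's Lemma 3 (`GuardedBallExists.PRel_ofFun_subset_polyExists_BPP_of_fnGraph`,
`PRelOfFunPolyExists.lean`: `P^g ⊆ ∃·BPP` when `graph(g) ∈ ∃·BPP`) this file assembles:

* `KIReduction.permanent01Graph_presentation_kiRed` — the KI presentation with the reduction NAMED
  (the landed fact hides it behind `∃ f ∈ FP`; same proof), `KIReduction.exists_kiRed_eq_circuitWord`;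
* `KIReduction.permanent01Graph_mem_polyExists_BPP_of_agree_kiRed` — `graph(per) ∈ ∃·BPP` from small
  constant-free circuits for `per` and ANY `B ∈ BPP` that agrees with `PITLanguage` on the values of
  `kiRed` (`…_of_agree`: on all instance codes);
* `PRel_per01_subset_polyExists_BPP` (`P^{per} ⊆ ∃·BPP`), `PSharpP_subset_polyExists_BPP_of_agree_kiRed`;
* `isVP0Family_perPoly_of_vp0EqVNP0`, `isPBounded_constantFreeComplexity_perPoly_of_vp0EqVNP0`;
* **`BIJL2018_thm5_of_randomizedPIT`**: `(∃ B ∈ BPP agreeing with PIT on the values of kiRed) →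
  BIJL2018_thm5`; corollaries `BIJL2018_thm5_of_randomizedPIT_circuitWord`,
  `BIJL2018_thm5_of_PIT_mem_BPP : PITLanguage ∈ BPP → BIJL2018_thm5`.

What remains for the discharge `BIJL2018_thm5_holds` is exactly such a `B`: a randomised identity
test for the codes of division-free integer circuits (ACIT ∈ coRP — Schwartz 1980, Ibarra–Moran 1983;
in the tree: `ModularZeroTest.mem_coRP_of_modularZeroTest` + the junk-tolerant code semantics
`CircuitCode.semPoly` + an `FP` evaluator of circuit codes modulo a random number).
HONEST FRAMING: a 2018 conditional transfer theorem with a Boolean conclusion, reduced inside the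
tree; `VP ≠ VNP` is NOT proved and nothing here bears on it.

## References

* M. Bläser, C. Ikenmeyer, G. Jindal, V. Lysikov, *Generalized matrix completion and algebraic
  natural proofs*, STOC 2018 = ECCC TR18-064, Thm. 5 and §6 [BlaserIkenmeyerJindalLysikov2018].
* V. Kabanets, R. Impagliazzo, *Derandomizing polynomial identity tests means proving circuit lower
  bounds*, STOC 2003, Lemma 3 (p. 357), Lemma 11 and Cor. 12 (p. 358) [KabanetsImpagliazzo2003].
* L. G. Valiant, *The complexity of computing the permanent*, TCS 8 (1979), Thm. 1 [Valiant1979].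
* J. T. Schwartz, J. ACM 27 (1980); O. H. Ibarra, S. Moran, J. ACM 30 (1983) [Schwartz1980]
  [IbarraMoran1983].
-/

noncomputable section

namespace Literature.Computability.AlgebraicComplexity

namespace KIReduction

open _root_.Computability Complexity Brick Polynomial ArithCircuit QuantumComplexity

/-! ### The Kabanets–Impagliazzo presentation of `graph(per)` with the reduction `kiRed` named -/

/-- The dimension is at most the length of the matrix code (copy of the private lemma of
`PermanentGraphNSUBEXPProofs.lean`). [cite: KabanetsImpagliazzo2003, §2.1 (p. 357)] -/
private theorem le_length_encode_matrix' {m : ℕ} (M : Fin m → Fin m → ℤ) :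
    m ≤ (encodingIntMatrix.encode ⟨m, M⟩).length := by
  rw [BosonCodes.encode_matrix_eq, length_boolPair, length_boolPair, KIReduction.length_ones']; omega

/-- **Every value of the reduction `kiRed` is the code of an identity-test instance** (`circuitWord`:
on a valid input the instance, otherwise the rejected word `circuitWord 0 (ofConst 1)`).
[cite: KabanetsImpagliazzo2003, Lemma 11 and proof of Cor. 12 (p. 358)] -/
theorem exists_kiRed_eq_circuitWord (w : List Bool) :
    ∃ (m : ℕ) (C : ArithCircuit ℤ (Fin m)), kiRed w = circuitWord m C := by
  rw [kiRed_apply]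
  split_ifs
  · exact ⟨_, _, rfl⟩
  · exact ⟨0, ofConst 1, rfl⟩

/-- **Kabanets–Impagliazzo 2003, Lemma 11 / proof of Cor. 12 with the reduction NAMED**: under
p-bounded constant-free circuits for `(PER_n)` there is a polynomial `p` with
`x ∈ permanent01Graph ↔ ∃ y, |y| ≤ p(|x|) ∧ kiRed ⟨x, y⟩ ∈ PIT` (the tree's
`permanent01Graph_polyExists_preimage_PIT_holds` hides `kiRed` behind an existential; same proof,
adapted from `PermanentGraphNSUBEXPProofs.lean`). [cite: KabanetsImpagliazzo2003, Lemma 11 and proof of Cor. 12 (p. 358)] -/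
theorem permanent01Graph_presentation_kiRed
    (hper : IsPBounded fun n => constantFreeComplexity (perPoly (Fin n) ℤ)) :
    ∃ p : Polynomial ℕ, ∀ x : List Bool,
      x ∈ permanent01Graph ↔
        ∃ y : List Bool, y.length ≤ p.eval x.length ∧ kiRed (boolPair x y) ∈ PITLanguage := by
  obtain ⟨c, hc⟩ := hper
  refine ⟨witnessPoly c, fun x => ⟨?_, ?_⟩⟩
  · -- completeness
    rintro ⟨m, M, hM, rfl⟩
    obtain ⟨P, hlen, hidx, hzero⟩ := exists_good_blocks m hc
    set v := ((Matrix.of M).permanent).toNat with hv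
    set Ps : List KBlock := (List.range (m + 1)).map P with hPs
    have hPi : ∀ i, i ≤ m → Ps.getD i [] = P i := fun i hi => by
      rw [hPs, List.getD_eq_getElem?_getD, List.getElem?_map, List.getElem?_range (Nat.lt_succ_of_le hi)]; rfl
    refine ⟨encBlocks Ps, ?_, ?_⟩
    · -- the witness is short
      have hs : ∀ B ∈ Ps, B.length ≤ m ^ c + c + 1 := by
        intro B hB
        rw [hPs, List.mem_map] at hB
        obtain ⟨i, hi, rfl⟩ := hB
        rw [List.mem_range] at hi
        exact (hlen i).trans (by have := Nat.pow_le_pow_left (Nat.le_of_lt_succ hi) c; omega)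
      have hI : ∀ B ∈ Ps, ∀ g ∈ B, g.a.idx < m * m + B.length ∧ g.b.idx < m * m + B.length := by
        intro B hB g hg
        rw [hPs, List.mem_map] at hB
        obtain ⟨i, -, rfl⟩ := hB
        exact hidx i g hg
      refine (length_encBlocks_le hs hI).trans ?_
      have hm := le_length_encode_matrix' M
      set L := (boolPair (encodingIntMatrix.encode ⟨m, M⟩) (encodeNat v)).length with hL
      have hmL : m ≤ L := hm.trans (by rw [hL, length_boolPair]; omega)
      have hPl : Ps.length = m + 1 := by rw [hPs, List.length_map, List.length_range]
      simp only [hPl, witnessPoly, Polynomial.eval_mul, Polynomial.eval_add, Polynomial.eval_pow,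
        Polynomial.eval_X, Polynomial.eval_C, Polynomial.eval_ofNat, Polynomial.eval_one]
      have h1 : m ^ c ≤ L ^ c := Nat.pow_le_pow_left hmL c
      have h2 : m * m ≤ L ^ 2 := by rw [pow_two]; exact Nat.mul_le_mul hmL hmL
      have h3 : m ^ c + c + 1 ≤ L ^ c + c + 1 := by omega
      have h4 : 6 * (m * m + (m ^ c + c + 1)) + 58 ≤ 6 * (L ^ 2 + (L ^ c + c + 1)) + 58 := by omega
      exact Nat.mul_le_mul (by omega) (Nat.add_le_add_right (Nat.mul_le_mul_left 2 (Nat.mul_le_mul h3 h4)) 2)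
    · -- the instance vanishes
      obtain ⟨M', hm', hMM', hred⟩ := kiRed_canonical M hM v (encBlocks Ps)
      rw [hred, circuitWord_mem_PITLanguage, kiCircuit_eval_cast hm' M M' hMM',
        kiCircuit_congr m M _ (P' := P) (fun i hi => by rw [readBlocks_encBlocks, hPi i hi])]
      have hvz : ((v : ℕ) : ℤ) = (Matrix.of M).permanent := by
        rw [hv, Int.toNat_of_nonneg (permanent_nonneg_of_zero_one M hM)]
      rw [hvz]
      exact hzero M
  · -- soundness
    rintro ⟨y, -, hy⟩
    by_cases hval : fstF (boolPair x y) = canonX (boolPair x y)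
    · rw [kiRed_apply, if_pos hval, circuitWord_mem_PITLanguage] at hy
      have hs := kiCircuit_sound _ _ _ _ hy
      rw [fstF_boolPair] at hval
      rw [hval, canonX]
      refine ⟨_, parsedM (boolPair x y), parsedM_zero_one _, ?_⟩
      rw [← hs, Int.toNat_natCast]
    · exact absurd (kiRed_of_ne hval ▸ hy) badWord_not_mem_PITLanguage

/-- **`graph(per) ∈ ∃·BPP` from small constant-free circuits and ANY bounded-error identity test
that is correct on the values of the reduction**: if `B ∈ BPP` agrees with `PITLanguage` on every
`kiRed w` (on other strings `B` is arbitrary), then `permanent01Graph ∈ polyExists BPP`: the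
presentation `∃ y, kiRed ⟨x, y⟩ ∈ PIT` becomes `∃ y, ⟨x, y⟩ ∈ kiRed ⁻¹' B`, and `BPP` is closed under
`FP`-preimages. (Kabanets–Impagliazzo 2003, proof of Cor. 12, with a randomised identity test —
Bläser–Ikenmeyer–Jindal–Lysikov 2018, proof of Thm. 5: "verify the circuits using polynomial identity
testing".) [cite: KabanetsImpagliazzo2003, Lemma 11 and proof of Cor. 12 (p. 358)] [cite: BlaserIkenmeyerJindalLysikov2018, Thm. 5 (proof, §6)] -/
theorem permanent01Graph_mem_polyExists_BPP_of_agree_kiRed {B : Language Bool} (hB : B ∈ BPP)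
    (hagree : ∀ w : List Bool, kiRed w ∈ B ↔ kiRed w ∈ PITLanguage)
    (hper : IsPBounded fun n => constantFreeComplexity (perPoly (Fin n) ℤ)) :
    permanent01Graph ∈ polyExists BPP := by
  obtain ⟨p, hp⟩ := permanent01Graph_presentation_kiRed hper
  refine ⟨kiRed ⁻¹' B, preimage_mem_BPP hB kiRed_mem_FP, p, fun x => ?_⟩
  rw [hp x]
  refine exists_congr fun y => and_congr Iff.rfl ?_
  change kiRed (boolPair x y) ∈ PITLanguage ↔ kiRed (boolPair x y) ∈ B
  rw [hagree]

/-- The same with agreement on ALL codes of identity-test instances (`circuitWord m C ∈ B ↔ C ≡ 0`):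
every value of `kiRed` is such a code (`exists_kiRed_eq_circuitWord`).
[cite: KabanetsImpagliazzo2003, Lemma 11 and proof of Cor. 12 (p. 358)] -/
theorem permanent01Graph_mem_polyExists_BPP_of_agree {B : Language Bool} (hB : B ∈ BPP)
    (hagree : ∀ (m : ℕ) (C : ArithCircuit ℤ (Fin m)), circuitWord m C ∈ B ↔ C.eval = 0)
    (hper : IsPBounded fun n => constantFreeComplexity (perPoly (Fin n) ℤ)) :
    permanent01Graph ∈ polyExists BPP := by
  refine permanent01Graph_mem_polyExists_BPP_of_agree_kiRed hB (fun w => ?_) hper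
  obtain ⟨m, C, hC⟩ := exists_kiRed_eq_circuitWord w
  rw [hC, circuitWord_mem_PITLanguage, hagree]

end KIReduction

end Literature.Computability.AlgebraicComplexity

namespace Literature.Barriers.ValiantsHypothesis

open Literature.Computability.Complexity Literature.Computability.AlgebraicComplexity
open Literature.Computability.QuantumComplexity _root_.Computability MvPolynomial

/-! ### The permanent oracle in `∃·BPP` -/

/-- **The full graph of the `0/1` permanent function is in `∃·BPP`** once the graph language on
canonical matrix codes is (the canonicalisation guarded ball `fnGraph_per01Fn_eq_guardedBall` of
`PRelPermanentNSUBEXP.lean`, in the witness class `∃·BPP`). [cite: KabanetsImpagliazzo2003, §2.1 and Lemma 3 (p. 357)] -/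
theorem fnGraph_per01Fn_mem_polyExists_BPP (h : permanent01Graph ∈ polyExists BPP) :
    fnGraph per01Fn ∈ polyExists BPP := by
  rw [fnGraph_per01Fn_eq_guardedBall]
  exact GuardedBallExists.guardedBall_mem_polyExists_BPP 0 h Rper_mem_P Sper_mem_P fper_mem_FP

/-- **`P^{per} ⊆ ∃·BPP` when `graph(per) ∈ ∃·BPP`** (Kabanets–Impagliazzo 2003, Lemma 3, in the
witness class `∃·BPP`: guess every oracle answer with its certificate; `BPP^{BPP} = BPP`).
[cite: KabanetsImpagliazzo2003, Lemma 3 (p. 357)] [cite: AroraBarakCC2009, §7.5.2] -/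
theorem PRel_per01_subset_polyExists_BPP (h : permanent01Graph ∈ polyExists BPP) :
    PRel (Oracle.ofFun per01Fn) ⊆ polyExists BPP := by
  obtain ⟨s, hs⟩ := exists_length_encodeNat_per01Fn_le
  exact GuardedBallExists.PRel_ofFun_subset_polyExists_BPP_of_fnGraph hs
    (fnGraph_per01Fn_mem_polyExists_BPP h)

/-- **`P^{#P} ⊆ ∃·BPP` from small constant-free circuits for the permanent and a bounded-error
identity test correct on the values of the reduction**: Valiant's theorem
(`PSharpP_subset_PRel_per01Fn permanent01_isSharpPHardFun_holds`) on top of the two steps above. This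
is the Boolean half of Bläser–Ikenmeyer–Jindal–Lysikov's proof of Thm. 5 (ECCC pp. 18–19), the
identity test abstracted into the hypotheses `hB`, `hagree` (randomised identity testing of
division-free integer circuits: Schwartz 1980, Ibarra–Moran 1983).
[cite: BlaserIkenmeyerJindalLysikov2018, Thm. 5 (proof, §6)] [cite: Valiant1979, Thm. 1] -/
theorem PSharpP_subset_polyExists_BPP_of_agree_kiRed {B : Language Bool} (hB : B ∈ BPP)
    (hagree : ∀ w : List Bool, KIReduction.kiRed w ∈ B ↔ KIReduction.kiRed w ∈ PITLanguage)
    (hper : IsPBounded fun n => constantFreeComplexity (perPoly (Fin n) ℤ)) :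
    PSharpP ⊆ polyExists BPP :=
  (PSharpP_subset_PRel_per01Fn permanent01_isSharpPHardFun_holds).trans
    (PRel_per01_subset_polyExists_BPP
      (KIReduction.permanent01Graph_mem_polyExists_BPP_of_agree_kiRed hB hagree hper))

/-! ### `VP⁰ = VNP⁰` gives the small circuits -/

/-- **Under `VP⁰ = VNP⁰` the permanent family `per_n ∈ ℤ[x_{11}, …, x_{nn}]` is a `VP⁰` family**
(Bläser–Ikenmeyer–Jindal–Lysikov 2018, §6, p. 17: "this set has a `VNP⁰`-natural proof, namely the
permanent itself"; `isVNP0Family_perPoly_finProd`, renamed back to the variables `Fin n × Fin n` as in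
`hasVP0NaturalProofsAgainstPerZero_of_vp0EqVNP0`). [cite: BlaserIkenmeyerJindalLysikov2018, §6 (p. 17) and Def. 29] -/
theorem isVP0Family_perPoly_of_vp0EqVNP0 (h : VP0EqVNP0) :
    IsVP0Family (σ := fun n => Fin n × Fin n) fun n => perPoly (Fin n) ℤ := by
  have hVP := h ⟨fun n => n * n,
    fun n => rename (finProdFinEquiv : Fin n × Fin n ≃ Fin (n * n)) (perPoly (Fin n) ℤ)⟩
    isVNP0Family_perPoly_finProd
  have hcard : IsPBounded fun n => Fintype.card (Fin n × Fin n) := by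
    refine (IsPBounded.iff_exists_le_mul_succ_pow _).2 ⟨1, 2, fun n => ?_⟩
    have e : 1 * (n + 1) ^ 2 = n * n + 2 * n + 1 := by ring
    simp only [Fintype.card_prod, Fintype.card_fin]
    omega
  have hVP' := hVP.rename (fun n => ((finProdFinEquiv : Fin n × Fin n ≃ Fin (n * n)).symm :
    Fin (n * n) → Fin n × Fin n)) hcard
  have e : (fun n => rename ((finProdFinEquiv : Fin n × Fin n ≃ Fin (n * n)).symm :
      Fin (n * n) → Fin n × Fin n)
      (rename (finProdFinEquiv : Fin n × Fin n ≃ Fin (n * n)) (perPoly (Fin n) ℤ))) =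
      fun n => perPoly (Fin n) ℤ := by
    funext n
    rw [rename_rename, Equiv.symm_comp_self, rename_id]
    rfl
  rwa [e] at hVP'

/-- **Under `VP⁰ = VNP⁰` the permanent has p-bounded constant-free complexity** (`τ(per_n) = n^{O(1)}`,
Bürgisser 2009, after Def. 2.7) — the hypothesis of the tree's Kabanets–Impagliazzo reduction.
[cite: BlaserIkenmeyerJindalLysikov2018, Thm. 5 (proof, §6)] -/
theorem isPBounded_constantFreeComplexity_perPoly_of_vp0EqVNP0 (h : VP0EqVNP0) :
    IsPBounded fun n => constantFreeComplexity (perPoly (Fin n) ℤ) :=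
  (isVP0Family_perPoly_of_vp0EqVNP0 h).isPBounded_constantFreeComplexity

/-! ### BIJL Thm. 5 reduced to randomised identity testing -/

/-- **Bläser–Ikenmeyer–Jindal–Lysikov 2018, Thm. 5, REDUCED TO A RANDOMISED IDENTITY TEST**: if some
`B ∈ BPP` agrees with `PITLanguage` (vanishing of division-free integer circuits, on their codes) at
every value of the Kabanets–Impagliazzo reduction `kiRed`, then `VP⁰ = VNP⁰ ⇒ P^{#P} ⊆ ∃·BPP` (the
typed fact `BIJL2018_thm5`). Route (ECCC pp. 18–19): `VP⁰ = VNP⁰` ⇒ small constant-free circuits for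
`per_n` (`isPBounded_constantFreeComplexity_perPoly_of_vp0EqVNP0`) ⇒ `graph(per) ∈ ∃·BPP` by
guessing the circuits and one randomised identity test
(`KIReduction.permanent01Graph_mem_polyExists_BPP_of_agree_kiRed`) ⇒ `P^{per} ⊆ ∃·BPP`
(`PRel_per01_subset_polyExists_BPP`) ⇒ `P^{#P} ⊆ P^{per} ⊆ ∃·BPP` (Valiant). The printed proof
evaluates the guessed circuits at random points directly, using the coefficient bound of its
Lemma 25; here the randomised identity test is the hypothesis. NOT the discharge of `BIJL2018_thm5`:
that needs such a `B` as a theorem of the tree (ACIT ∈ coRP on these codes: Schwartz 1980,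
Ibarra–Moran 1983). [cite: BlaserIkenmeyerJindalLysikov2018, Thm. 5] locator: ECCC p.6 (statement), pp.18–19 (proof) -/
theorem BIJL2018_thm5_of_randomizedPIT {B : Language Bool} (hB : B ∈ BPP)
    (hagree : ∀ w : List Bool, KIReduction.kiRed w ∈ B ↔ KIReduction.kiRed w ∈ PITLanguage) :
    BIJL2018_thm5 :=
  fun h => PSharpP_subset_polyExists_BPP_of_agree_kiRed hB hagree
    (isPBounded_constantFreeComplexity_perPoly_of_vp0EqVNP0 h)

/-- **BIJL Thm. 5 from a `BPP` test correct on all instance codes** (`circuitWord m C ∈ B ↔ C ≡ 0`).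
[cite: BlaserIkenmeyerJindalLysikov2018, Thm. 5] -/
theorem BIJL2018_thm5_of_randomizedPIT_circuitWord {B : Language Bool} (hB : B ∈ BPP)
    (hagree : ∀ (m : ℕ) (C : ArithCircuit ℤ (Fin m)), KIReduction.circuitWord m C ∈ B ↔ C.eval = 0) :
    BIJL2018_thm5 := by
  refine BIJL2018_thm5_of_randomizedPIT hB fun w => ?_
  obtain ⟨m, C, hC⟩ := KIReduction.exists_kiRed_eq_circuitWord w
  rw [hC, KIReduction.circuitWord_mem_PITLanguage, hagree]

/-- **BIJL Thm. 5 from `PIT ∈ BPP`** (the tree's `PITLanguage`, Kabanets–Impagliazzo's ACIT): the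
special case `B = PITLanguage`. [cite: BlaserIkenmeyerJindalLysikov2018, Thm. 5] -/
theorem BIJL2018_thm5_of_PIT_mem_BPP (hPIT : PITLanguage ∈ BPP) : BIJL2018_thm5 :=
  BIJL2018_thm5_of_randomizedPIT hPIT fun _ => Iff.rfl

end Literature.Barriers.ValiantsHypothesis

end
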